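import Summits.QuantumFields.BalabanUV.T4Continuum.Support.NE7CriticalFirstVariation
import Summits.QuantumFields.BalabanUV.T4Continuum.Support.NE7QbarCurvedBaseTower
import Summits.QuantumFields.BalabanUV.T4Continuum.Support.NE7SliceLetterBalabanGauge
import HarnessLib

/-!
# NE7CriticalFirstVariationGeneral — [B8] (1.9) FOR TANGENT-CRITICAL CONFIGURATIONS OVER AN ARBITRARY DATUM (g72's R1 without the flat-top hypothesis): the
# first variation of the Wilson action of a TANGENT-CRITICAL configuration of the multi-level class has `(ℓ¹)*`-density `c_R·Λ_U` on ALL skew periodic directions,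
# `Λ_U = K_maj·(L∕L^d)^{k+1}` the `ℓ¹` letter of the straight tower `Q̄_U` AT `U` ITSELF — i.e. `|D*F| ≲ C·δ·M⁻³`, the small-CURRENT clause of Bałaban's class (6),
# which puts our tangent-critical configurations into [B11] Prop. 8's hypothesis class (item (SF0) of gen 88's shopping list)

Cell `pub-balaban`, rung (B)+1 sub-cell t4, lineage `b2b-balaban-t4-ne7-p1` (CRUX PROVER NE7 #1 = OWNER of row NE7), generation 88; memo
`t4/b2b-balaban-t4-ne7-p1-g88/EXISTENCE-BY-INDUCTION.md` §5 (SF0).  File F244 (over g72's R1 `NE7CriticalFirstVariation` (F52∕F53's mechanism), row NE3's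
`NE3TangentCovariantTower` (`dirIter_eq_QbarIter_add_gaugeDir`, `dirIter_gaugeDir` — valid at EVERY background), F84's `NE7QbarCurvedBaseTower.sum_norm_QbarIter_le_prod` +
`NE7MajorantL1.prod_step_le` (the `ℓ¹` letter of `Q̄_U` at a curved `U`), `NE7SliceLetterBalabanGauge.gaugeDir_neg_pi`).

WHY.  [Balaban1985Variational] Prop. 8 (= F31's `hape`, gen 88's print read) is stated for critical configurations of Bałaban's class (6) = `𝔘_k({Ω_j}, ε₀) ∩ 𝔅_k(V)`,
and `𝔘_k` carries, besides the plaquette radius (1.7)∕(1.8), the small-CURRENT clause [B8] (1.9) `|D*_U ∂U(b)| < α₀η²(L^jη)^{−3}` ([B11] (2) carries both); the tree's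
`sfClass` has the plaquette clause only.  g72's R1 (`abs_dAction_le_of_tanCritical`) proved that for TANGENT-CRITICAL configurations (1.9) is a CONSEQUENCE — but
only at the trivial flat datum (`cavgIter L (k+1) U = 1`), because its `ℓ¹` letter for `Q̄_U` went through the flat tower `Q^{(k+1)}` plus a comparison letter `Λ`.
THIS FILE removes the flat-top hypothesis: (i) the frame-absorption identity `D_U(Z + gaugeDir_U λ) = Q̄_U Z` holds at ANY top (the two coarse gauge directions
`gaugeDir_{U_top}(±F_U Z)` cancel by linearity — no `U_top = 1` needed); (ii) the `ℓ¹` letter of `Q̄_U` is taken AT `U` (F84's product majorant, `K_maj·(L∕L^d)^{k+1}`).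
WHAT ([folklore]; 0 def, 0 sorry; generic `d`).
§1 **`dirIter_add_gaugeDir_eq_Qbar_general`** — §1 of g72 at an arbitrary top.
§2 **`abs_dAction_le_of_tanCritical_gauge_general`** — abstract exact right inverse `R` with first-variation bound `c_R` and a DIRECT `ℓ¹` letter `Λ_U` of `Q̄_U`:
   `|dAction U Z (perWin)| ≤ c_R·Λ_U·‖Z‖₁` for every skew periodic `Z`, `U` tangent-critical.
§3 **`abs_dAction_le_of_tanCritical_general`** — `R := rightInvW` (`c_R = a·(curl1C∕(1−θℓ))·M^d∕M²`, F53) and `Λ_U := K_maj(d,L)·(L∕L^d)^{k+1}` (F84 + `prod_step_le`):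
   for `U` unitary `(N·L^{k+1})`-periodic in the W5∕W6 regime with `SmallField U a`, TANGENT-CRITICAL, ANY top: `|dAction U Z| ≤ a·(curl1C∕(1−θℓ))·(M^d∕M²)·K_maj·
   (L∕L^d)^{k+1}·‖Z‖₁` — with `a = δM⁻²` this is `C(d,L)·δ·M⁻³·‖Z‖₁` (g72's `density_currency` with `2C_Sα̂ := K_maj − 1`), [B8] (1.9)'s `α₀η³`, `α₀ ∝ δ`.
HONEST FRAMING (page 1): composition of tree theorems (row NE3's structure theorem and right inverse, g72's mechanism, F84's majorant); nothing of Bałaban's asserted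
— [B8] (1.9) p. 77 is a TEXT LOCATION; this is the DICTIONARY item (SF0) of the Prop. 8 road, not Prop. 8; NOT (APE), NOT ONE-STEP, NOT NE7; spine 0∕9; finite T⁴
rung (B)+1 — NOT infinite volume, NOT mass gap, NOT `BetaPertH`, NOT Clay.  Continuum YM on T⁴ ⇐ BetaPertH ∧ nine spine estimates (0/9 proved); BetaPertH ⇐ (D1) ∧
(D4) ∧ CAP+tail; G-an2-4 gates asym, D1 and NE2/3/4.
-/

set_option autoImplicit false

open scoped BigOperators Matrix.Norms.L2Operator
open NormedSpace Finset

namespace Summit.QuantumFields.BalabanUV.T4Continuum.NE7CriticalFirstVariationGeneral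

open Literature.MathematicalPhysics.QuantumFieldTheory.Balaban1983to89
open B7Prop1Explicit B7Prop2Explicit MatrixLog UnitaryModel
open T4AveragingDeficitWall (IsUnitaryCfg IsSkewDir SmallField dirL1)
open T4AveragingDeficitWallBoundary (IsPeriodicCfg periodBox)
open AveragingDeficitPeriodicCounting (IsPeriodicDir)
open AveragingDeficitTwoLevelPrep (prop1Radius twoLevelSmall)
open AveragingDeficitMultiLevelPrep (cavgIter LevelSmall tower)
open AveragingDeficitMultiLevelBridge (tower_eq)
open MinimalActionLevels (perWin)
open BlockAveragePushDirGauge (gaugeDir isPeriodicDir_gaugeDir)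
open BlockAverageVaryHolo (nbRad)
open NE3TangentCovariantTower (dirIter QbarIter framePotW dirIter_add dirIter_gaugeDir dirIter_eq_QbarIter_add_gaugeDir)
open NE3CurvedFrameKill (framePotW_skew_periodic pow_succ_mul_eq_tower)
open NE3LandauOrbit (gaugeDir_skew)
open NE3ResidualSliceRep (dirIter_sub)
open NE3HessForm (dAction)
open NE3PureGaugeFirstVariation (dAction_gaugeDir)
open NE3QbarIterCovLiftPrep (cruxC)
open NE3SmoothRightInverseW (rightInvW)
open NE3RightInverseSolveLetters (thetaLoc)
open NE3HatInvCurlLetters (curl1C curl1C_nonneg)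
open NE3RightInverseLetters (rightInvW_exact rightInvW_skew rightInvW_periodic)
open NE7TangentTransportGauge (dAction_sub' dirIter_skew_periodic cornerLift_smul cornerLift_add_period)
open NE7TangentTransportRightInv (abs_dAction_rightInvW_le)
open NE7QbarCurvedBaseTower (sum_norm_QbarIter_le_prod)
open NE7MajorantL1 (prod_step_le)
open NE7SliceLetterBalabanGauge (gaugeDir_neg_pi)

noncomputable section

variable {d : ℕ} {n : Type*} [Fintype n] [DecidableEq n]

/-! ## §1 Absorbing the frames of the linearised average by a fine gauge direction — at an ARBITRARY top -/

/-- **`D_U(Z + gaugeDir_U λ) = Q̄^{(k+1)}_U Z` AT ANY TOP** for the corner lift `λ` of `−framePotW L (k+1) U Z`: row NE3's structure theorem `D_U Z = Q̄_U Z +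
gaugeDir_{U_top}(F_U Z)` and `D_U(gaugeDir_U λ) = gaugeDir_{U_top}(λ∘M•) = gaugeDir_{U_top}(−F_U Z)` — the two coarse gauge directions cancel by linearity (g72's §1
needed `U_top = 1` only to see this cancellation through `gaugeDir_1 = −dPot`). [folklore] -/
theorem dirIter_add_gaugeDir_eq_Qbar_general [Nonempty n] {L N : ℕ} [NeZero N] (hL : 1 ≤ L) (k : ℕ)
    {U : Site d → Fin d → (Matrix n n ℂ)ˣ} {x : ℝ} (hUu : IsUnitaryCfg U) (hUP : IsPeriodicCfg U ((tower L N (k + 1) : ℕ) : ℤ))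
    (hx : 0 ≤ x) (hs : LevelSmall d L k x) (hUx : SmallField U x)
    {Z : Site d → Fin d → Matrix n n ℂ} (hZ : IsSkewDir Z) (hZP : IsPeriodicDir Z ((tower L N (k + 1) : ℕ) : ℤ)) (z : Site d) (κ : Fin d) :
    dirIter L (k + 1) U (fun y μ => Z y μ
        + gaugeDir U (fun xx : Site d => (fun w => -framePotW L (k + 1) U Z w) (fun i => xx i / ((L : ℤ) ^ (k + 1)))) y μ) z κ
      = QbarIter L (k + 1) U Z z κ := by
  have hm : ((L : ℤ) ^ (k + 1)) ≠ 0 := pow_ne_zero _ (by exact_mod_cast (show L ≠ 0 by omega))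
  have htow : ((tower L N (k + 1) : ℕ) : ℤ) = (L : ℤ) ^ (k + 1) * (N : ℤ) := (pow_succ_mul_eq_tower L N k).symm
  set g : Site d → Matrix n n ℂ := fun w => -framePotW L (k + 1) U Z w with hg
  obtain ⟨hFUs, hFUP⟩ := framePotW_skew_periodic (M := N) hL k hUu hUP hx hs hUx hZ hZP
  have hgs : ∀ w, g w ∈ skewAdjoint (Matrix n n ℂ) := fun w => (skewAdjoint (Matrix n n ℂ)).neg_mem (hFUs w)
  have hgP : ∀ (w : Site d) (i : Fin d), g (w + (N : ℤ) • e i) = g w := fun w i => by simp only [hg, hFUP w i]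
  set lam : Site d → Matrix n n ℂ := fun xx => g (fun i => xx i / ((L : ℤ) ^ (k + 1))) with hlam
  have hlams : ∀ xx, lam xx ∈ skewAdjoint (Matrix n n ℂ) := fun xx => hgs _
  have hlamP : ∀ (y : Site d) (i : Fin d), lam (y + ((tower L N (k + 1) : ℕ) : ℤ) • e i) = lam y := fun y i => by
    rw [htow]; exact cornerLift_add_period g hm hgP y i
  have hlam_corner : (fun y : Site d => lam (((L : ℤ) ^ (k + 1)) • y)) = g := by
    funext y; exact cornerLift_smul g hm y
  have hadd := dirIter_add hL k hUu hx hs hUx Z (gaugeDir U lam)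
  have hgauge := dirIter_gaugeDir (M := N) hL k hUu hUP hx hs hUx hlams hlamP
  have hstr := dirIter_eq_QbarIter_add_gaugeDir (M := N) hL k hUu hUP hx hs hUx hZ hZP
  have h1 := congr_fun (congr_fun hadd z) κ
  have h2 := congr_fun (congr_fun hgauge z) κ
  have h3 := congr_fun (congr_fun hstr z) κ
  rw [h1, h2, h3, hlam_corner]
  simp only [hg, gaugeDir_neg_pi]
  abel

/-! ## §2 The first variation of a tangent-critical configuration — abstract right inverse, direct `ℓ¹` letter of `Q̄_U` -/

/-- **THE FIRST-VARIATION DENSITY OF A TANGENT-CRITICAL CONFIGURATION AT ANY TOP (abstract right inverse).**  `U` unitary `T`-periodic (`T = L^{k+1}·N`), multi-level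
class; an exact right inverse `R` of `D_U` on skew `N`-periodic coarse data with first-variation bound `c_R`; the DIRECT `ℓ¹` letter `Λ_U` of the straight tower `Q̄_U` at
`U`; TANGENT-CRITICALITY of `U`.  THEN for EVERY skew `T`-periodic `Z`: `|dAction U Z (perWin d T)| ≤ c_R·Λ_U·‖Z‖_{ℓ¹(periodBox T)}`.  Proof = g72's: `dAction_U Z =
dAction_U(Z + gaugeDir_Uλ) = dAction_U(R ψ)`, `ψ = D_U(Z + gaugeDir_Uλ) = Q̄_U Z` (§1), `|·| ≤ c_R‖ψ‖₁ ≤ c_RΛ_U‖Z‖₁`. [folklore] -/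
theorem abs_dAction_le_of_tanCritical_gauge_general [Nonempty n] {L N : ℕ} [NeZero N] (hL : 1 ≤ L) (k : ℕ)
    {U : Site d → Fin d → (Matrix n n ℂ)ˣ} {x : ℝ} (hUu : IsUnitaryCfg U) (hUP : IsPeriodicCfg U ((tower L N (k + 1) : ℕ) : ℤ))
    (hx : 0 ≤ x) (hs : LevelSmall d L k x) (hUx : SmallField U x)
    (R : (Site d → Fin d → Matrix n n ℂ) → Site d → Fin d → Matrix n n ℂ)
    (hRskew : ∀ φ : Site d → Fin d → Matrix n n ℂ, IsSkewDir φ → IsPeriodicDir φ (N : ℤ) → IsSkewDir (R φ))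
    (hRper : ∀ φ : Site d → Fin d → Matrix n n ℂ, IsSkewDir φ → IsPeriodicDir φ (N : ℤ) →
      IsPeriodicDir (R φ) ((tower L N (k + 1) : ℕ) : ℤ))
    (hRexact : ∀ φ : Site d → Fin d → Matrix n n ℂ, IsSkewDir φ → IsPeriodicDir φ (N : ℤ) → dirIter L (k + 1) U (R φ) = φ)
    {cR : ℝ} (hcR : 0 ≤ cR)
    (hRbd : ∀ φ : Site d → Fin d → Matrix n n ℂ, IsSkewDir φ → IsPeriodicDir φ (N : ℤ) →
      |dAction U (R φ) (perWin d (tower L N (k + 1)))| ≤ cR * dirL1 φ (periodBox (d := d) N))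
    {ΛU : ℝ}
    (hΛU : ∀ Y : Site d → Fin d → Matrix n n ℂ, IsSkewDir Y → IsPeriodicDir Y ((tower L N (k + 1) : ℕ) : ℤ) →
      ∑ z ∈ periodBox N, ∑ κ : Fin d, ‖QbarIter L (k + 1) U Y z κ‖ ≤ ΛU * dirL1 Y (periodBox (d := d) (tower L N (k + 1))))
    (hcrit : ∀ Y' : Site d → Fin d → Matrix n n ℂ, IsSkewDir Y' → IsPeriodicDir Y' ((tower L N (k + 1) : ℕ) : ℤ) →
      dirIter L (k + 1) U Y' = 0 → dAction U Y' (perWin d (tower L N (k + 1))) = 0)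
    {Z : Site d → Fin d → Matrix n n ℂ} (hZ : IsSkewDir Z) (hZP : IsPeriodicDir Z ((tower L N (k + 1) : ℕ) : ℤ)) :
    |dAction U Z (perWin d (tower L N (k + 1)))| ≤ cR * ΛU * dirL1 Z (periodBox (d := d) (tower L N (k + 1))) := by
  have hm : ((L : ℤ) ^ (k + 1)) ≠ 0 := pow_ne_zero _ (by exact_mod_cast (show L ≠ 0 by omega))
  have htow : ((tower L N (k + 1) : ℕ) : ℤ) = (L : ℤ) ^ (k + 1) * (N : ℤ) := (pow_succ_mul_eq_tower L N k).symm
  -- the generator of §1 and its letters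
  set g : Site d → Matrix n n ℂ := fun w => -framePotW L (k + 1) U Z w with hg
  set lam : Site d → Matrix n n ℂ := fun xx => g (fun i => xx i / ((L : ℤ) ^ (k + 1))) with hlam
  obtain ⟨hFUs, hFUP⟩ := framePotW_skew_periodic (M := N) hL k hUu hUP hx hs hUx hZ hZP
  have hgs : ∀ w, g w ∈ skewAdjoint (Matrix n n ℂ) := fun w => (skewAdjoint (Matrix n n ℂ)).neg_mem (hFUs w)
  have hgP : ∀ (w : Site d) (i : Fin d), g (w + (N : ℤ) • e i) = g w := fun w i => by simp only [hg, hFUP w i]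
  have hlams : ∀ xx, lam xx ∈ skewAdjoint (Matrix n n ℂ) := fun xx => hgs _
  have hlamP : ∀ (y : Site d) (i : Fin d), lam (y + ((tower L N (k + 1) : ℕ) : ℤ) • e i) = lam y := fun y i => by
    rw [htow]; exact cornerLift_add_period g hm hgP y i
  -- the gauge-corrected direction `Z₁ = Z + gaugeDir_U λ` and its average `ψ = Q̄_U Z`
  set G : Site d → Fin d → Matrix n n ℂ := gaugeDir U lam with hG
  have hGs : IsSkewDir G := gaugeDir_skew hUu hlams
  have hGP : IsPeriodicDir G ((tower L N (k + 1) : ℕ) : ℤ) := isPeriodicDir_gaugeDir hUP hlamP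
  set Z₁ : Site d → Fin d → Matrix n n ℂ := fun y μ => Z y μ + G y μ with hZ₁
  have hZ₁s : IsSkewDir Z₁ := fun y μ => (skewAdjoint (Matrix n n ℂ)).add_mem (hZ y μ) (hGs y μ)
  have hZ₁P : IsPeriodicDir Z₁ ((tower L N (k + 1) : ℕ) : ℤ) := fun y i μ => by simp only [hZ₁, hZP y i μ, hGP y i μ]
  set ψ : Site d → Fin d → Matrix n n ℂ := dirIter L (k + 1) U Z₁ with hψ
  obtain ⟨hψs, hψP⟩ := dirIter_skew_periodic (M := N) hL k hUu hUP hx hs hUx hZ₁s hZ₁P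
  have hψeq : ∀ (w : Site d) (τ : Fin d), ψ w τ = QbarIter L (k + 1) U Z w τ :=
    fun w τ => dirIter_add_gaugeDir_eq_Qbar_general hL k hUu hUP hx hs hUx hZ hZP w τ
  -- the tangent field `Z₁ − Rψ` and criticality
  have hTs : IsSkewDir (fun y μ => Z₁ y μ - R ψ y μ) := fun y μ => (skewAdjoint (Matrix n n ℂ)).sub_mem (hZ₁s y μ) (hRskew ψ hψs hψP y μ)
  have hTP : IsPeriodicDir (fun y μ => Z₁ y μ - R ψ y μ) ((tower L N (k + 1) : ℕ) : ℤ) := fun y i μ => by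
    simp only [hZ₁P y i μ, hRper ψ hψs hψP y i μ]
  have hTT : dirIter L (k + 1) U (fun y μ => Z₁ y μ - R ψ y μ) = 0 := by
    rw [dirIter_sub hL k hUu hx hs hUx Z₁ (R ψ), hRexact ψ hψs hψP]
    funext w τ
    simp [hψ]
  have hc := hcrit _ hTs hTP hTT
  rw [dAction_sub', sub_eq_zero] at hc
  -- `dAction U Z = dAction U Z₁ = dAction U (Rψ)`
  have hZZ₁ : dAction U Z (perWin d (tower L N (k + 1))) = dAction U Z₁ (perWin d (tower L N (k + 1))) := by
    have e1 : Z = fun y μ => Z₁ y μ - G y μ := by funext y μ; simp only [hZ₁]; abel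
    conv_lhs => rw [e1]
    rw [dAction_sub', hG, dAction_gaugeDir, sub_zero]
  rw [hZZ₁, hc]
  refine (hRbd ψ hψs hψP).trans ?_
  -- `‖ψ‖₁ = ‖Q̄_U Z‖₁ ≤ Λ_U‖Z‖₁`
  have hψ1 : dirL1 ψ (periodBox (d := d) N) ≤ ΛU * dirL1 Z (periodBox (d := d) (tower L N (k + 1))) := by
    have h1 := hΛU Z hZ hZP
    have he : dirL1 ψ (periodBox (d := d) N) = ∑ w ∈ periodBox N, ∑ τ : Fin d, ‖QbarIter L (k + 1) U Z w τ‖ := by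
      unfold dirL1
      exact Finset.sum_congr rfl fun w _ => Finset.sum_congr rfl fun τ _ => by rw [hψeq]
    rw [he]; exact h1
  calc cR * dirL1 ψ (periodBox (d := d) N) ≤ cR * (ΛU * dirL1 Z (periodBox (d := d) (tower L N (k + 1)))) :=
        mul_le_mul_of_nonneg_left hψ1 hcR
    _ = _ := by ring

/-! ## §3 The letter at `R := rightInvW`, `Λ_U := K_maj·(L∕L^d)^{k+1}` — ANY top -/

/-- **THE FIRST-VARIATION DENSITY OF A TANGENT-CRITICAL CONFIGURATION OVER AN ARBITRARY DATUM** (`R := rightInvW`, `c_R = a·(curl1C∕(1−θℓ))·(M^d∕M²)` as F53;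
`Λ_U = K_maj(d,L)·(L∕L^d)^{k+1}` from F84's product majorant and `prod_step_le`): for `U` unitary `(N·L^{k+1})`-periodic with class radius `x ≥ 0`, `LevelSmall d L k x`,
`cruxC·M²x < 1`, `thetaLoc·M²x < 1`, `M²x ≤ 1`, `SmallField U a`, `a ≥ 0`, `L ≥ 2`, TANGENT-CRITICAL — and NO hypothesis on its top average — every skew
`(N·L^{k+1})`-periodic `Z` has `|dAction U Z (perWin)| ≤ a·(curl1C∕(1−θℓ))·(M^d∕M²)·K_maj·(L∕L^d)^{k+1}·‖Z‖_{ℓ¹(periodBox (N·L^{k+1}))}`; with `a = δM⁻²` this is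
`C(d,L)·δ·M⁻³·‖Z‖₁` — [B8] (1.9)'s `α₀η³` with `α₀ ∝ δ`. [folklore] -/
theorem abs_dAction_le_of_tanCritical_general [Nonempty n] {L : ℕ} (hL : 2 ≤ L) (k : ℕ) {N : ℕ} [NeZero N] {U : Site d → Fin d → (Matrix n n ℂ)ˣ} {x a : ℝ}
    (hUu : IsUnitaryCfg U) (hUP : IsPeriodicCfg U ((N * L ^ (k + 1) : ℕ) : ℤ)) (hx : 0 ≤ x) (hs : LevelSmall d L k x) (hUx : SmallField U x)
    (hθ : cruxC d L * (((L : ℝ) ^ (k + 1)) ^ 2 * x) < 1) (hθl : thetaLoc d L * (((L : ℝ) ^ (k + 1)) ^ 2 * x) < 1)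
    (hε : ((L : ℝ) ^ (k + 1)) ^ 2 * x ≤ 1) (ha : 0 ≤ a) (hUa : SmallField U a)
    (hcrit : ∀ Y' : Site d → Fin d → Matrix n n ℂ, IsSkewDir Y' → IsPeriodicDir Y' ((N * L ^ (k + 1) : ℕ) : ℤ) →
      dirIter L (k + 1) U Y' = 0 → dAction U Y' (perWin d (N * L ^ (k + 1))) = 0)
    {Z : Site d → Fin d → Matrix n n ℂ} (hZ : IsSkewDir Z) (hZP : IsPeriodicDir Z ((N * L ^ (k + 1) : ℕ) : ℤ)) :
    |dAction U Z (perWin d (N * L ^ (k + 1)))|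
      ≤ ((a * ((curl1C d L / (1 - thetaLoc d L * (((L : ℝ) ^ (k + 1)) ^ 2 * x))) * (((L : ℝ) ^ (k + 1)) ^ d / ((L : ℝ) ^ (k + 1)) ^ 2)))
          * (Real.exp (((L : ℝ) ^ d / L) * ((d : ℝ) * (16 * ((d : ℝ) + 1) * ((d : ℝ) + 4) * (L : ℝ) ^ 2)
              * (1250 * ((nbRad d L : ℝ) + L) + 8 * ((d : ℝ) * L) + 2 * L)) * (2 / twoLevelSmall d L))
            * ((L : ℝ) / (L : ℝ) ^ d) ^ (k + 1)))
        * dirL1 Z (periodBox (d := d) (N * L ^ (k + 1))) := by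
  classical
  have hL1 : 1 ≤ L := le_trans (by norm_num) hL
  have htowN : tower L N (k + 1) = N * L ^ (k + 1) := tower_eq L N (k + 1)
  have htow : ((tower L N (k + 1) : ℕ) : ℤ) = ((N * L ^ (k + 1) : ℕ) : ℤ) := by rw [htowN]
  have hUP' : IsPeriodicCfg U ((tower L N (k + 1) : ℕ) : ℤ) := by rw [htow]; exact hUP
  -- the right inverse as a plain function (classical case split on skewness), as F53 ∕ g72
  set R : (Site d → Fin d → Matrix n n ℂ) → Site d → Fin d → Matrix n n ℂ :=
    fun φ => if h : IsSkewDir φ then rightInvW hL k hUu hx hs hUx N hθ h else 0 with hR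
  have hRdef : ∀ φ : Site d → Fin d → Matrix n n ℂ, ∀ h : IsSkewDir φ, R φ = rightInvW hL k hUu hx hs hUx N hθ h := fun φ h => by
    simp only [hR, dif_pos h]
  set cR : ℝ := a * ((curl1C d L / (1 - thetaLoc d L * (((L : ℝ) ^ (k + 1)) ^ 2 * x))) * (((L : ℝ) ^ (k + 1)) ^ d / ((L : ℝ) ^ (k + 1)) ^ 2))
    with hcR
  have hcR0 : 0 ≤ cR := by
    have hpos : 0 < 1 - thetaLoc d L * (((L : ℝ) ^ (k + 1)) ^ 2 * x) := by linarith
    have := curl1C_nonneg d L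
    rw [hcR]; positivity
  have hRskew : ∀ φ : Site d → Fin d → Matrix n n ℂ, IsSkewDir φ → IsPeriodicDir φ (N : ℤ) → IsSkewDir (R φ) := fun φ hφ _ => by
    rw [hRdef φ hφ]; exact rightInvW_skew hL k hUu hx hs hUx hθ hφ
  have hRper : ∀ φ : Site d → Fin d → Matrix n n ℂ, IsSkewDir φ → IsPeriodicDir φ (N : ℤ) →
      IsPeriodicDir (R φ) ((tower L N (k + 1) : ℕ) : ℤ) := fun φ hφ _ => by
    rw [hRdef φ hφ, htow]; exact rightInvW_periodic hL k hUu hUP' hx hs hUx hθ hφ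
  have hRexact : ∀ φ : Site d → Fin d → Matrix n n ℂ, IsSkewDir φ → IsPeriodicDir φ (N : ℤ) → dirIter L (k + 1) U (R φ) = φ := fun φ hφ hφP => by
    rw [hRdef φ hφ]; exact rightInvW_exact hL k hUu hUP' hx hs hUx hθ hφ hφP
  have hRbd : ∀ φ : Site d → Fin d → Matrix n n ℂ, IsSkewDir φ → IsPeriodicDir φ (N : ℤ) →
      |dAction U (R φ) (perWin d (tower L N (k + 1)))| ≤ cR * dirL1 φ (periodBox (d := d) N) := fun φ hφ hφP => by
    rw [hRdef φ hφ, htowN]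
    exact abs_dAction_rightInvW_le hL k hUu hUP' hx hs hUx hθ hθl hε ha hUa hφ
  -- the direct `ℓ¹` letter of `Q̄_U` at `U`
  set ΛU : ℝ := Real.exp (((L : ℝ) ^ d / L) * ((d : ℝ) * (16 * ((d : ℝ) + 1) * ((d : ℝ) + 4) * (L : ℝ) ^ 2)
              * (1250 * ((nbRad d L : ℝ) + L) + 8 * ((d : ℝ) * L) + 2 * L)) * (2 / twoLevelSmall d L))
            * ((L : ℝ) / (L : ℝ) ^ d) ^ (k + 1) with hΛU
  have hΛ : ∀ Y : Site d → Fin d → Matrix n n ℂ, IsSkewDir Y → IsPeriodicDir Y ((tower L N (k + 1) : ℕ) : ℤ) →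
      ∑ z ∈ periodBox N, ∑ κ : Fin d, ‖QbarIter L (k + 1) U Y z κ‖ ≤ ΛU * dirL1 Y (periodBox (d := d) (tower L N (k + 1))) := by
    intro Y _ hYP
    rw [htowN]; rw [htow] at hYP
    have h1 := sum_norm_QbarIter_le_prod (P := N) hL1 k hUu hx hs hUx hYP
    have h2 := prod_step_le (d := d) hL k hx hs
    have hZ0 : 0 ≤ dirL1 Y (periodBox (d := d) (N * L ^ (k + 1))) := by
      unfold dirL1; exact Finset.sum_nonneg fun _ _ => Finset.sum_nonneg fun _ _ => norm_nonneg _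
    exact h1.trans (mul_le_mul_of_nonneg_right h2 hZ0)
  have hcrit' : ∀ Y' : Site d → Fin d → Matrix n n ℂ, IsSkewDir Y' → IsPeriodicDir Y' ((tower L N (k + 1) : ℕ) : ℤ) →
      dirIter L (k + 1) U Y' = 0 → dAction U Y' (perWin d (tower L N (k + 1))) = 0 := fun Y' hY's hY'P hY'T => by
    rw [htowN]; rw [htow] at hY'P; exact hcrit Y' hY's hY'P hY'T
  have hZP' : IsPeriodicDir Z ((tower L N (k + 1) : ℕ) : ℤ) := by rw [htow]; exact hZP
  have h := abs_dAction_le_of_tanCritical_gauge_general hL1 k hUu hUP' hx hs hUx R hRskew hRper hRexact hcR0 hRbd hΛ hcrit' hZ hZP'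
  rw [htowN] at h
  simpa only [hcR, hΛU] using h

end

end Summit.QuantumFields.BalabanUV.T4Continuum.NE7CriticalFirstVariationGeneral
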